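import Literature.AnabelianGeometry.AbsoluteAnabelian.FreeProSigmaCyclicClosedSubgroups
import Literature.AnabelianGeometry.AbsoluteAnabelian.FreeProlCyclicEncoding
import HarnessLib

/-!
# `Ẑ^Σ` is pro-`Σ`; every closed subgroup of `Ẑ^Σ` is topologically monogenic

A short bridge between the two typings of "`≅ Ẑ^Σ`" / "`≅ ℤ_l`" in the tree, requested by
abc-iut-L4-t6 (STATUS 2026-08-26T01:56:18Z) after the reciprocal audits of `FreeProSigmaCyclicSubgroups`
(abc-iut-w5-d024) and `FreeProlCyclicEncoding` (abc-iut-L4-t6):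

* `AbsTopII.IsFreeProSigmaCyclic.isProSigma` — a compact free pro-`Σ`-cyclic group ([AbsTopII] Prop. 1.3
  (i), intrinsic predicate `AbsTopII.IsFreeProSigmaCyclic Σ`) is pro-`Σ` in layer L3's sense
  `SemiGraphs.IsProSigma Σ` ([CombGC] Def. 1.1 (ii)): every open normal subgroup has index a
  `Σ`-integer, so the primes dividing the orders of the finite quotients lie in `Σ`;
* `AbsTopII.IsFreeProSigmaCyclic.exists_topologicalClosure_zpowers_eq_of_isClosed` — **every closed
  subgroup of `Ẑ^Σ` is the closure of a cyclic subgroup** (closed subgroups are free pro-`Σ'`-cyclic,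
  `FreeProSigmaCyclicClosedSubgroups`, hence have a dense cyclic subgroup);
* `AbsTopII.IsFreeProSigmaCyclic.isFreeProSigmaCyclic_singleton_iff_infinite_of_isClosed` — for a closed
  subgroup `H` of a free pro-`{l}`-cyclic profinite group: `H ≅ ℤ_l` (intrinsically) iff `H` is
  infinite — the encoding lemma of `FreeProlCyclicEncoding` at the ambient `Π := G` itself, where it
  agrees with the dichotomy `eq_bot_or_singleton_of_isClosed`.

Proof-only (no definitions); classical profinite group theory [cite: RibesZalesskii2010, Thm 2.7.1].
HONEST FRAMING: nothing here bears on [IUTchIII] Cor. 3.12; typed ≠ proved elsewhere; no side is taken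
on any disputed claim.
-/

noncomputable section

namespace Literature.AnabelianGeometry.AbsoluteAnabelian

open Literature.AnabelianGeometry.Anabelioids (IsSigmaInteger)
open Literature.AnabelianGeometry.SemiGraphs (IsProSigma)

universe u

variable {G : Type u} [Group G] [TopologicalSpace G]

/-- **`Ẑ^Σ` is pro-`Σ`.**  A compact free pro-`Σ`-cyclic group is pro-`Σ` in the sense of layer L3
(`SemiGraphs.IsProSigma`): for an open normal subgroup `U`, `|G/U| = [G : U]` is a `Σ`-integer.
[cite: MochizukiCombGC2007, Def 1.1(ii) p.6] [cite: MochizukiAbsTopII2013, Prop 1.3 (i) p.11] -/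
theorem AbsTopII.IsFreeProSigmaCyclic.isProSigma {S : Set ℕ} [CompactSpace G]
    (h : AbsTopII.IsFreeProSigmaCyclic S G) : IsProSigma S G := by
  refine ⟨fun U _ p hp hpd => ?_⟩
  have hidx : IsSigmaInteger S U.toSubgroup.index :=
    (h.isOpen_index_iff _).mp ⟨U.toSubgroup, U.toOpenSubgroup.isOpen, rfl⟩
  rw [← Subgroup.index_eq_card] at hpd
  exact hidx.2 p hp hpd

variable [IsTopologicalGroup G]

/-- **Every closed subgroup of `Ẑ^Σ` is topologically monogenic**: in a compact Hausdorff totally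
disconnected free pro-`Σ`-cyclic group, every closed subgroup `H` is the closure of a cyclic
subgroup `⟨a⟩` of `G` (`H` is free pro-`Σ'`-cyclic for some `Σ' ⊆ Σ`, so it has a dense cyclic
subgroup; closedness turns density in `H` into `closure_G ⟨a⟩ = H`).
[cite: MochizukiAbsTopII2013, Prop 1.3 (i) p.11] -/
theorem AbsTopII.IsFreeProSigmaCyclic.exists_topologicalClosure_zpowers_eq_of_isClosed {S : Set ℕ}
    [CompactSpace G] [T2Space G] [TotallyDisconnectedSpace G] (h : AbsTopII.IsFreeProSigmaCyclic S G)
    (H : Subgroup G) (hH : IsClosed (H : Set G)) :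
    ∃ a : G, (Subgroup.zpowers a).topologicalClosure = H := by
  obtain ⟨S', -, -, hH'⟩ := h.exists_subset_of_isClosed H hH
  exact hH'.exists_topologicalClosure_zpowers_eq hH

/-- **`Σ = {l}`: a closed subgroup of a `ℤ_l`-group is `≅ ℤ_l` iff it is infinite.**  For a closed
subgroup `H` of a compact Hausdorff totally disconnected free pro-`{l}`-cyclic group `G` (`l` prime):
`IsFreeProSigmaCyclic {l} H ↔ H` infinite — abc-iut-L4-t6's encoding lemma
(`isFreeProSigmaCyclic_singleton_iff_of_isProSigma`) applied to the ambient `Π := G`, which is pro-`l`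
by `IsFreeProSigmaCyclic.isProSigma`, the monogenicity conjunct being automatic
(`exists_topologicalClosure_zpowers_eq_of_isClosed`). [cite: MochizukiAbsTopI2012, Lemma 4.5 (iv) p.54] -/
theorem AbsTopII.IsFreeProSigmaCyclic.isFreeProSigmaCyclic_singleton_iff_infinite_of_isClosed {l : ℕ}
    [hl : Fact l.Prime] [CompactSpace G] [T2Space G] [TotallyDisconnectedSpace G]
    (h : AbsTopII.IsFreeProSigmaCyclic {l} G) (H : Subgroup G) (hH : IsClosed (H : Set G)) :
    AbsTopII.IsFreeProSigmaCyclic {l} ↥H ↔ (H : Set G).Infinite := by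
  rw [AbsTopII.isFreeProSigmaCyclic_singleton_iff_of_isProSigma h.isProSigma hH]
  exact ⟨fun h1 => h1.2, fun hinf => ⟨h.exists_topologicalClosure_zpowers_eq_of_isClosed H hH, hinf⟩⟩

end Literature.AnabelianGeometry.AbsoluteAnabelian

end
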